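import Literature.MathematicalPhysics.QuantumFieldTheory.QuasiLocalGaugePerturbationDecoupling
import Mathlib.MeasureTheory.Integral.Pi
import HarnessLib

/-!
# Quasi-local gauge-invariant perturbations, VII-c: kernel-uniform rarity of active marks (F2)

Companion ("theorems only") file of `QuasiLocalGaugePerturbationDecoupling.lean`. In the joint
`(U, mark)` system of a perturbation `W`, resampling ANY set `M` of marks with everything else
frozen, the marks are independent Bernoulli variables with
`P(n_X = 1 | U) = p_X h_X(U) / ((1 - p_X) + p_X h_X(U)) ≤ r_X := p_X (1 + e^{2 s_X})`
(`jointSpec_marks_real_allActive`, an exact product formula — Fubini over the mark coordinates,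
`integral_fintype_prod_eq_prod`). Consequences:

* `jointSpec_marks_allActive_le` — `γ_M({n_X = 1 ∀ X ∈ M} | ξ) ≤ ∏_{X ∈ M} r_X` for EVERY
  boundary condition `ξ` (the kernel-uniform Peierls bound for the second defect species of the
  two-species engine);
* `jointSpec_preimage_uOf_inter_allActive_le` — next to any event of the link field and inside
  any larger resampled volume: `γ_Λ({U ∈ B} ∩ {n_M ≡ 1} | ξ) ≤ (∏_{X∈M} r_X) γ_Λ({U ∈ B} | ξ)`
  (consistency: resample the marks of `M` last; properness: this does not move `U`).

## References

* H.-O. Georgii, *Gibbs Measures and Phase Transitions* (2011), Def. 1.23 (consistency,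
  properness), Ch. 8.
* R. G. Edwards, A. D. Sokal, Phys. Rev. D 38 (1988) 2009 (conditional bond laws of joint
  representations).
-/

noncomputable section

open MeasureTheory Finset
open scoped ENNReal
open Literature.Probability.LatticeModels (glueWith glueWith_apply_mem glueWith_apply_not_mem
  measurable_glueWith Specification IsSpecification IsGibbsMeasure
  integral_tilted_map_eq_integral_tilted_comp)
open Literature.MathematicalPhysics.QuantumLattice

namespace Literature.MathematicalPhysics.QuantumFieldTheory

namespace QuasiLocalGaugePerturbation

variable {d N : ℕ} [NeZero N] {G : Type*} [Group G] [MeasurableSpace G] {b : ℕ}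
  [TopologicalSpace G] [IsTopologicalGroup G] [CompactSpace G] [BorelSpace G]
  {Nρ : ℕ} (ρ : G →* Matrix (Fin Nρ) (Fin Nρ) ℂ) (W : QuasiLocalGaugePerturbation d N G b)

/-! ### Per-site integrals at a mark site -/

/-- Integral of a function of the mark against the reference law of a far polymer. [folklore] -/
theorem integral_jointRef_inr (X : FarPoly b d N) (g : Bool → ℝ) :
    ∫ s, g s.2 ∂(W.jointRef (Sum.inr X)) = (1 - W.pAct X.1) * g false + W.pAct X.1 * g true := by
  simp only [jointRef, Sum.elim_inr]
  rw [Measure.dirac_prod, integral_map measurable_prodMk_left.aemeasurable]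
  · exact integral_bern (W.pAct_nonneg X.1) (W.pAct_le_one X.1) g
  · exact (Measurable.of_discrete.comp measurable_snd).aestronglyMeasurable

/-- `∫ exp(siteTerm) = (1 - p_X) + p_X h_X(U)` at a far polymer. [folklore] -/
theorem integral_exp_siteTerm_inr (X : FarPoly b d N) (U : GaugeConfig d N G) :
    ∫ s, Real.exp (W.siteTerm U (Sum.inr X) s) ∂(W.jointRef (Sum.inr X)) =
      (1 - W.pAct X.1) + W.pAct X.1 * W.hTilt X.1 U := by
  have h := W.integral_jointRef_inr X
    (fun n => Real.exp (if n then Real.log (W.hTilt X.1 U) else 0))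
  simp only [siteTerm, Sum.elim_inr] at h ⊢
  rw [h]
  simp [Real.exp_log (W.hTilt_pos X.1 U)]

/-- `∫ exp(siteTerm) · 1_{active} = p_X h_X(U)` at a far polymer. [folklore] -/
theorem integral_exp_siteTerm_mul_ind_inr (X : FarPoly b d N) (U : GaugeConfig d N G) :
    ∫ s, Real.exp (W.siteTerm U (Sum.inr X) s) * (if s.2 = true then (1 : ℝ) else 0)
        ∂(W.jointRef (Sum.inr X)) = W.pAct X.1 * W.hTilt X.1 U := by
  have h := W.integral_jointRef_inr X
    (fun n => Real.exp (if n then Real.log (W.hTilt X.1 U) else 0) * (if n = true then (1 : ℝ) else 0))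
  simp only [siteTerm, Sum.elim_inr] at h ⊢
  rw [h]
  simp [Real.exp_log (W.hTilt_pos X.1 U)]


/-! ### The law of resampled marks -/

variable (hρ : Continuous ρ) [SecondCountableTopology G]
include hρ

/-- **The explicit law of resampled marks**: resampling the marks of `M` only, the probability
that they are all active is `∏_{X ∈ M} p_X h_X(U) / ((1 - p_X) + p_X h_X(U))`, `U` the
(unchanged) link field. [folklore] -/
theorem jointSpec_marks_real_allActive (β : ℝ) (M : Finset (FarPoly b d N))
    (ξ : JSite b d N → G × Bool) :
    (W.jointSpec ρ β (M.map (marksEmb b d N)) ξ).real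
        {σ | ∀ X ∈ M, markOf σ X = true} =
      ∏ X ∈ M, W.pAct X.1 * W.hTilt X.1 (uOf ξ) /
        ((1 - W.pAct X.1) + W.pAct X.1 * W.hTilt X.1 (uOf ξ)) := by
  classical
  set M' : Finset (JSite b d N) := M.map (marksEmb b d N) with hM'
  set U := uOf ξ with hU
  set E : Set (JSite b d N → G × Bool) := {σ | ∀ X ∈ M, markOf σ X = true} with hE
  have hmemM' : ∀ v ∈ M', ∃ X ∈ M, Sum.inr X = v := fun v hv => by
    simpa [hM'] using hv
  have hEmeas : MeasurableSet E := by
    have : E = ⋂ X ∈ M, {σ | markOf σ X = true} := by ext σ; simp [hE]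
    rw [this]
    exact Finset.measurableSet_biInter M fun X _ =>
      measurableSet_eq_fun (measurable_markOf X) measurable_const
  -- the factorised integrands
  set F : JSite b d N → G × Bool → ℝ := fun v s => Real.exp (W.siteTerm U v s) with hF
  set ind : JSite b d N → G × Bool → ℝ :=
    Sum.elim (fun _ _ => 1) (fun _ s => if s.2 then 1 else 0) with hind
  set A : ℝ := (-β * wilsonAction ρ U - (W.restrict fun X => X.card = 1).total U) +
    ∑ v ∈ M'ᶜ, W.siteTerm U v (ξ v) with hA
  -- energy of a glued configuration
  have hφ : ∀ u : ↥M' → G × Bool, Real.exp (W.jointEnergy ρ β (glueWith M' u ξ)) =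
      Real.exp A * ∏ v : ↥M', F v.1 (u v) := by
    intro u
    rw [jointEnergy_eq, uOf_glueWith_map_inr, ← hU, ← Finset.sum_add_sum_compl M', hA,
      show (-β * wilsonAction ρ U - (W.restrict fun X => X.card = 1).total U) +
          (∑ v ∈ M', W.siteTerm U v (glueWith M' u ξ v) +
            ∑ v ∈ M'ᶜ, W.siteTerm U v (glueWith M' u ξ v)) =
          ((-β * wilsonAction ρ U - (W.restrict fun X => X.card = 1).total U) +
            ∑ v ∈ M'ᶜ, W.siteTerm U v (glueWith M' u ξ v)) +
            ∑ v ∈ M', W.siteTerm U v (glueWith M' u ξ v) by ring]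
    have hout : ∑ v ∈ M'ᶜ, W.siteTerm U v (glueWith M' u ξ v) =
        ∑ v ∈ M'ᶜ, W.siteTerm U v (ξ v) :=
      Finset.sum_congr rfl fun v hv => by
        rw [glueWith_apply_not_mem _ _ _ (Finset.mem_compl.1 hv)]
    have hin : ∑ v ∈ M', W.siteTerm U v (glueWith M' u ξ v) =
        ∑ v : ↥M', W.siteTerm U v.1 (u v) := by
      rw [← Finset.sum_coe_sort]
      exact Finset.sum_congr rfl fun v _ => by rw [glueWith_apply_mem _ _ _ v.2]
    rw [hout, hin, Real.exp_add, Real.exp_sum]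
  -- indicator of the event on a glued configuration
  have hindE : ∀ u : ↥M' → G × Bool, E.indicator (1 : (JSite b d N → G × Bool) → ℝ)
      (glueWith M' u ξ) = ∏ v : ↥M', ind v.1 (u v) := by
    intro u
    have hprod : ∏ v : ↥M', ind v.1 (u v) = ∏ v : ↥M', (if (u v).2 = true then (1 : ℝ) else 0) := by
      refine Finset.prod_congr rfl fun v _ => ?_
      obtain ⟨X, -, hX⟩ := hmemM' v.1 v.2
      rw [← hX]
      simp [hind]
    rw [hprod, Finset.prod_boole]
    by_cases hmem : glueWith M' u ξ ∈ E
    · rw [Set.indicator_of_mem hmem, Pi.one_apply, if_pos]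
      intro v _
      obtain ⟨X, hXM, hX⟩ := hmemM' v.1 v.2
      have := hmem X hXM
      simp only [markOf] at this
      rwa [hX, glueWith_apply_mem _ _ _ v.2] at this
    · rw [Set.indicator_of_notMem hmem, if_neg]
      intro hall
      apply hmem
      intro X hXM
      have hv : Sum.inr X ∈ M' := Finset.mem_map.2 ⟨X, hXM, rfl⟩
      simp only [markOf]
      rw [glueWith_apply_mem _ _ _ hv]
      exact hall ⟨Sum.inr X, hv⟩ (Finset.mem_univ _)
  -- the reference product measure on the resampled marks
  set π : Measure (↥M' → G × Bool) := Measure.pi fun v : ↥M' => W.jointRef v with hπ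
  have hφm : Measurable (W.jointEnergy ρ β) := W.measurable_jointEnergy ρ hρ β
  -- per-site integrals
  set IF : JSite b d N → ℝ := fun v => ∫ s, F v s ∂(W.jointRef v) with hIF
  set IFi : JSite b d N → ℝ := fun v => ∫ s, F v s * ind v s ∂(W.jointRef v) with hIFi
  have hIF_inr : ∀ X : FarPoly b d N, IF (Sum.inr X) =
      (1 - W.pAct X.1) + W.pAct X.1 * W.hTilt X.1 U := fun X => by
    simp only [hIF, hF]
    exact W.integral_exp_siteTerm_inr X U
  have hIFi_inr : ∀ X : FarPoly b d N, IFi (Sum.inr X) = W.pAct X.1 * W.hTilt X.1 U := fun X => by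
    simp only [hIFi, hF, hind, Sum.elim_inr]
    exact W.integral_exp_siteTerm_mul_ind_inr X U
  have hIF_pos : ∀ v ∈ M', 0 < IF v := fun v hv => by
    obtain ⟨X, -, rfl⟩ := hmemM' v hv
    rw [hIF_inr]
    have h1 := W.one_le_hTilt X.1 U
    have hp := W.pAct_nonneg X.1
    have hp1 := W.pAct_le_one X.1
    nlinarith
  -- the normaliser
  have hZ : ∫ y, Real.exp (W.jointEnergy ρ β (glueWith M' y ξ)) ∂π =
      Real.exp A * ∏ v : ↥M', IF v.1 := by
    simp_rw [hφ]
    rw [integral_const_mul]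
    congr 1
    exact integral_fintype_prod_eq_prod (𝕜 := ℝ) (fun (v : ↥M') (s : G × Bool) => F v.1 s)
  have hP_pos : 0 < ∏ v : ↥M', IF v.1 := Finset.prod_pos fun v _ => hIF_pos v.1 v.2
  -- the numerator
  have hNum : ∫ y, Real.exp (W.jointEnergy ρ β (glueWith M' y ξ)) *
      E.indicator (1 : (JSite b d N → G × Bool) → ℝ) (glueWith M' y ξ) ∂π =
      Real.exp A * ∏ v : ↥M', IFi v.1 := by
    simp_rw [hφ, hindE]
    have : ∀ y : ↥M' → G × Bool, Real.exp A * (∏ v : ↥M', F v.1 (y v)) * ∏ v : ↥M', ind v.1 (y v) =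
        Real.exp A * ∏ v : ↥M', (F v.1 (y v) * ind v.1 (y v)) := fun y => by
      rw [mul_assoc, Finset.prod_mul_distrib]
    simp_rw [this]
    rw [integral_const_mul]
    congr 1
    exact integral_fintype_prod_eq_prod (𝕜 := ℝ) (fun (v : ↥M') (s : G × Bool) => F v.1 s * ind v.1 s)
  -- assemble
  rw [← integral_indicator_one hEmeas]
  simp only [jointSpec]
  rw [integral_tilted_map_eq_integral_tilted_comp π (measurable_glueWith M' ξ) hφm
    (measurable_one.indicator hEmeas), integral_tilted]
  simp only [Function.comp_def, smul_eq_mul]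
  rw [hZ]
  have hrw : ∀ y : ↥M' → G × Bool,
      Real.exp (W.jointEnergy ρ β (glueWith M' y ξ)) / (Real.exp A * ∏ v : ↥M', IF v.1) *
        E.indicator 1 (glueWith M' y ξ) =
      (Real.exp A * ∏ v : ↥M', IF v.1)⁻¹ *
        (Real.exp (W.jointEnergy ρ β (glueWith M' y ξ)) * E.indicator 1 (glueWith M' y ξ)) :=
    fun y => by rw [div_eq_mul_inv]; ring
  simp_rw [hrw]
  rw [integral_const_mul, hNum]
  have hA0 : Real.exp A ≠ 0 := (Real.exp_pos A).ne'
  rw [mul_inv, show (Real.exp A)⁻¹ * (∏ v : ↥M', IF v.1)⁻¹ * (Real.exp A * ∏ v : ↥M', IFi v.1) =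
    ((Real.exp A)⁻¹ * Real.exp A) * ((∏ v : ↥M', IFi v.1) / ∏ v : ↥M', IF v.1) by ring,
    inv_mul_cancel₀ hA0, one_mul, ← Finset.prod_div_distrib]
  -- back to a product over `M`
  rw [Finset.prod_coe_sort M' (fun v => IFi v / IF v), hM', Finset.prod_map]
  refine Finset.prod_congr rfl fun X _ => ?_
  rw [marksEmb_apply, hIFi_inr, hIF_inr]


/-- **Kernel-uniform rarity of active marks (F2)**: resampling the marks of `M` only, whatever
the rest of the configuration, the probability that all of them are active is at most
`∏_{X ∈ M} r_X` (`r_X = p_X (1 + e^{2 s_X}) ≤ 2 s_X (1 + e^{2 s_X})`). [folklore] -/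
theorem jointSpec_marks_allActive_le [MeasurableSingletonClass G] (β : ℝ)
    (M : Finset (FarPoly b d N)) (ξ : JSite b d N → G × Bool) :
    W.jointSpec ρ β (M.map (marksEmb b d N)) ξ
        {σ | ∀ X ∈ M, markOf σ X = true} ≤ ENNReal.ofReal (∏ X ∈ M, W.rAct X.1) := by
  haveI := (W.isSpecification_jointSpec ρ hρ (b := b) β).isProbability
    (M.map (marksEmb b d N)) ξ
  rw [← ofReal_measureReal (measure_ne_top _ _), W.jointSpec_marks_real_allActive ρ hρ β M ξ]
  refine ENNReal.ofReal_le_ofReal (Finset.prod_le_prod (fun X _ => ?_) fun X _ => ?_)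
  · have h1 := W.one_le_hTilt X.1 (uOf ξ)
    have hp := W.pAct_nonneg X.1
    have hp1 := W.pAct_le_one X.1
    exact div_nonneg (by nlinarith) (by nlinarith)
  · have h1 := W.one_le_hTilt X.1 (uOf ξ)
    have h2 := W.hTilt_le X.1 (uOf ξ)
    have hp := W.pAct_nonneg X.1
    have hp1 := W.pAct_le_one X.1
    have hden : 1 ≤ (1 - W.pAct X.1) + W.pAct X.1 * W.hTilt X.1 (uOf ξ) := by nlinarith
    calc W.pAct X.1 * W.hTilt X.1 (uOf ξ) / ((1 - W.pAct X.1) + W.pAct X.1 * W.hTilt X.1 (uOf ξ))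
        ≤ W.pAct X.1 * W.hTilt X.1 (uOf ξ) := div_le_self (by nlinarith) hden
      _ ≤ W.rAct X.1 := mul_le_mul_of_nonneg_left h2 hp

/-- **Rarity of active marks next to a link-field event**: resampling a volume `Λ` containing
the mark sites of `M`, for every measurable event `B` of the link field,
`γ_Λ({U ∈ B} ∩ {n_X = 1 ∀ X ∈ M} | ξ) ≤ (∏_{X ∈ M} r_X) · γ_Λ({U ∈ B} | ξ)` (consistency: resample
the marks of `M` last; properness: this does not move `U`). [folklore] -/
theorem jointSpec_preimage_uOf_inter_allActive_le [MeasurableSingletonClass G] (β : ℝ)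
    (Λ : Finset (JSite b d N)) (M : Finset (FarPoly b d N))
    (hM : M.map (marksEmb b d N) ⊆ Λ) (ξ : JSite b d N → G × Bool)
    {B : Set (GaugeConfig d N G)} (hB : MeasurableSet B) :
    W.jointSpec ρ β Λ ξ ((uOf ⁻¹' B) ∩ {σ | ∀ X ∈ M, markOf σ X = true}) ≤
      ENNReal.ofReal (∏ X ∈ M, W.rAct X.1) * W.jointSpec ρ β Λ ξ (uOf ⁻¹' B) := by
  have hγ := W.isSpecification_jointSpec ρ hρ (b := b) β
  set M' := M.map (marksEmb b d N) with hM'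
  set E : Set (JSite b d N → G × Bool) := {σ | ∀ X ∈ M, markOf σ X = true} with hE
  have hEm : MeasurableSet E := measurableSet_allActive M
  have hBm : MeasurableSet (uOf ⁻¹' B : Set (JSite b d N → G × Bool)) := measurable_uOf hB
  -- consistency: resample the marks of `M` last
  rw [← hγ.consistent hM ξ _ (hBm.inter hEm), ← hγ.consistent hM ξ _ hBm]
  -- properness of the mark kernel: `{U ∈ B}` is an outside event
  have hcyl := measurableSet_cylinderEvents_preimage_uOf M hB
  have hinner : ∀ σ, W.jointSpec ρ β M' σ ((uOf ⁻¹' B) ∩ E) ≤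
      ENNReal.ofReal (∏ X ∈ M, W.rAct X.1) * W.jointSpec ρ β M' σ (uOf ⁻¹' B) := fun σ => by
    haveI := hγ.isProbability M' σ
    have h1 : W.jointSpec ρ β M' σ ((uOf ⁻¹' B) ∩ E) =
        (uOf ⁻¹' B).indicator 1 σ * W.jointSpec ρ β M' σ E := by
      rw [Set.inter_comm]; exact hγ.measure_inter_of_cylinderEvents M' E hcyl σ
    have h2 : W.jointSpec ρ β M' σ (uOf ⁻¹' B) = (uOf ⁻¹' B).indicator 1 σ := by
      have := hγ.measure_inter_of_cylinderEvents M' Set.univ hcyl σ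
      rwa [Set.univ_inter, measure_univ, mul_one] at this
    rw [h1, h2]
    calc (uOf ⁻¹' B).indicator 1 σ * W.jointSpec ρ β M' σ E
        ≤ (uOf ⁻¹' B).indicator 1 σ * ENNReal.ofReal (∏ X ∈ M, W.rAct X.1) := by
          gcongr
          exact W.jointSpec_marks_allActive_le ρ hρ β M σ
      _ = ENNReal.ofReal (∏ X ∈ M, W.rAct X.1) * (uOf ⁻¹' B).indicator 1 σ := mul_comm _ _
  calc ∫⁻ σ, W.jointSpec ρ β M' σ ((uOf ⁻¹' B) ∩ E) ∂(W.jointSpec ρ β Λ ξ)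
      ≤ ∫⁻ σ, ENNReal.ofReal (∏ X ∈ M, W.rAct X.1) * W.jointSpec ρ β M' σ (uOf ⁻¹' B)
          ∂(W.jointSpec ρ β Λ ξ) := lintegral_mono fun σ => hinner σ
    _ = ENNReal.ofReal (∏ X ∈ M, W.rAct X.1) *
          ∫⁻ σ, W.jointSpec ρ β M' σ (uOf ⁻¹' B) ∂(W.jointSpec ρ β Λ ξ) := by
        rw [lintegral_const_mul'' _ (hγ.measurable_coe M' hBm).aemeasurable]

end QuasiLocalGaugePerturbation

end Literature.MathematicalPhysics.QuantumFieldTheory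

end
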